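import Literature.AlgebraicGeometry.Resolution.StrictTransformLocality
import HarnessLib

/-!
# The ideal of the strict transform is the exceptional-power torsion (Stacks 080C/080D)

Topic: `Literature/AlgebraicGeometry/Resolution`. The dictionary between the scheme-theoretic
strict transform used by the named fact `Stacks081R` (`blowupStrictTransform f b 𝓘`, the
scheme-theoretic closure of `(X ×_S S')|_{S' ∖ E}`, Stacks 080D (2)) and the module-theoretic
strict transform of Stacks 080C (1) / 0810 ("`M' = (M ⊗_R R')/a-power torsion`"): on an affine
open `W` of `X ×_S S'` on which the pulled-back exceptional divisor is cut out by one equation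
`t`, the ideal of the strict transform consists exactly of the `t`-power torsion sections
(Stacks, Tag 080C: "(1) the subsheaf of sections supported on `E`, (2) the scheme-theoretic
closure of the complement of `E`, agree"). This is the entry point of any module-theoretic
continuation (Fitting-ideal blow-ups, Stacks 0810–0815) of the reduction chain
`stacks081R_of_affine` / `stacks081R_of_embedded`.

* `mem_ker_ι_ideal_iff_exists_pow_mul_eq_zero` — for a quasi-compact open `O ↪ T`, an affine
  open `W` and `t ∈ Γ(T, W)` with `O ∩ W = D(t)`: a section over `W` lies in the ideal of the
  scheme-theoretic closure of `O` iff it is killed by a power of `t`;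
* `exists_affineOpens_inf_eq_basicOpen` — around every point of `X ×_S S'` there is such a
  chart for `O = (X ×_S S')|_{S' ∖ E}`, `E = b⁻¹V(𝓘)` an effective Cartier divisor;
* `mem_ideal_blowupStrictTransform_iff` — **the ideal of the strict transform on such a chart is
  the `t`-power torsion.**

## References

* The Stacks Project, Tag 080C (Divisors, Definition 31.33.1 and the discussion preceding it:
  sections supported on `E` vs. scheme-theoretic closure), Tag 080D, Tag 0810. [StacksProject]
-/

noncomputable section

open CategoryTheory CategoryTheory.Limits AlgebraicGeometry TopologicalSpace

namespace Literature.AlgebraicGeometry.Resolution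

universe u

/-- Vanishing of a restriction does not depend on the presentation of the smaller open.
[folklore] -/
theorem presheaf_map_eq_zero_congr {T : Scheme.{u}} {W V₁ V₂ : T.Opens} (e : V₁ = V₂) (h₁ : V₁ ≤ W)
    (h₂ : V₂ ≤ W) (x : Γ(T, W)) :
    T.presheaf.map (homOfLE h₁).op x = 0 ↔ T.presheaf.map (homOfLE h₂).op x = 0 := by
  subst e
  rfl

/-- **Sections in the ideal of a scheme-theoretic closure of a principal open are the torsion
sections.** For a quasi-compact open immersion `O ↪ T`, an affine open `W ⊆ T` and
`t ∈ Γ(T, W)` with `O ∩ W = D(t)`, a section `x ∈ Γ(T, W)` lies in the ideal of the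
scheme-theoretic image of `O ↪ T` iff `tⁿ x = 0` for some `n` (the ideal on `W` is the kernel of
`Γ(W) → Γ(D(t)) = Γ(W)[1/t]`). [cite: StacksProject, Tag 080C] -/
theorem mem_ker_ι_ideal_iff_exists_pow_mul_eq_zero {T : Scheme.{u}} (O : T.Opens)
    [QuasiCompact O.ι] (W : T.affineOpens) (t : Γ(T, W))
    (hW : O ⊓ (W : T.Opens) = T.basicOpen t) (x : Γ(T, W)) :
    x ∈ O.ι.ker.ideal W ↔ ∃ n : ℕ, t ^ n * x = 0 := by
  haveI := W.2.isLocalization_basicOpen t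
  have e : O.ι ''ᵁ O.ι ⁻¹ᵁ (W : T.Opens) = T.basicOpen t := by
    rw [Scheme.Hom.image_preimage_eq_opensRange_inf, Scheme.Opens.opensRange_ι, hW]
  rw [Scheme.Hom.ker_apply, RingHom.mem_ker]
  have key : (O.ι.app W).hom x = 0 ↔ (T.presheaf.map (homOfLE (T.basicOpen_le t)).op) x = 0 :=
    presheaf_map_eq_zero_congr e (Set.image_preimage_subset _ _) (T.basicOpen_le t) x
  rw [key]
  change algebraMap Γ(T, W) Γ(T, T.basicOpen t) x = 0 ↔ _
  rw [IsLocalization.map_eq_zero_iff (Submonoid.powers t)]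
  constructor
  · rintro ⟨⟨_, n, rfl⟩, hn⟩
    exact ⟨n, hn⟩
  · rintro ⟨n, hn⟩
    exact ⟨⟨t ^ n, n, rfl⟩, hn⟩

section StrictTransform

variable {X S S' : Scheme.{u}} (f : X ⟶ S) (b : S' ⟶ S) (I : S.IdealSheafData)

/-- **Charts on which the pulled-back exceptional divisor is principal.** If `b⁻¹𝓘 𝒪_{S'}` is
an effective Cartier divisor `E`, every point of `X ×_S S'` has an affine open neighbourhood
`W` with `W ∖ E = D(t)` for a section `t ∈ Γ(W)` (the pull-back of a local equation of `E`).
[cite: StacksProject, Tag 080C] -/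
theorem exists_affineOpens_inf_eq_basicOpen (hE : IsEffectiveCartier (I.comap b))
    (x : ↑(pullback f b)) :
    ∃ (W : (pullback f b).affineOpens) (t : Γ(pullback f b, W)), x ∈ (W : (pullback f b).Opens) ∧
      (pullback.snd f b ⁻¹ᵁ (b ⁻¹ᵁ centreCompl I)) ⊓ (W : (pullback f b).Opens) =
        (pullback f b).basicOpen t := by
  obtain ⟨V, hxV, s, -, hsV⟩ := hE (pullback.snd f b x)
  -- an affine open `W ∋ x` inside `snd⁻¹ V`
  obtain ⟨W', hW', hxW', hW'V⟩ := exists_isAffineOpen_mem_and_subset (X := pullback f b) (x := x)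
    (U := pullback.snd f b ⁻¹ᵁ (V : S'.Opens)) hxV
  refine ⟨⟨W', hW'⟩, (pullback f b).presheaf.map (homOfLE hW'V).op
    ((pullback.snd f b).app (V : S'.Opens) s), hxW', ?_⟩
  -- `snd⁻¹(S' ∖ E) ∩ W' = W' ∩ snd⁻¹ D(s) = W' ∩ D(snd* s)` as `W' ⊆ snd⁻¹ V` and `V ∖ E = D(s)`
  have key : ∀ y, y ∈ (W' : Set _) →
      (y ∈ pullback.snd f b ⁻¹ᵁ centreCompl (I.comap b) ↔ pullback.snd f b y ∈ S'.basicOpen s) := by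
    intro y hyW
    have hyV : pullback.snd f b y ∈ ((V : S'.Opens) : Set S') := hW'V hyW
    have hset := inter_centreCompl_eq_basicOpen V s hsV
    constructor
    · intro hyO
      have hmem : pullback.snd f b y ∈ ((V : S'.Opens) : Set S') ∩ (centreCompl (I.comap b) : Set S') :=
        Set.mem_inter hyV hyO
      rw [hset] at hmem
      exact hmem
    · intro hys
      have hmem : pullback.snd f b y ∈ ((V : S'.Opens) : Set S') ∩ (centreCompl (I.comap b) : Set S') := by
        rw [hset]
        exact hys
      exact hmem.2
  rw [Scheme.basicOpen_res, ← Scheme.preimage_basicOpen, preimage_centreCompl]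
  apply le_antisymm
  · intro y hy
    have hy' := Opens.mem_inf.mp hy
    exact Opens.mem_inf.mpr ⟨hy'.2, (key y hy'.2).mp hy'.1⟩
  · intro y hy
    have hy' := Opens.mem_inf.mp hy
    exact Opens.mem_inf.mpr ⟨(key y hy'.1).mpr hy'.2, hy'.1⟩

/-- **The ideal of the strict transform is the exceptional-power torsion** (Stacks 080C (1) =
(2) for the structure sheaf): with `b⁻¹𝓘 𝒪_{S'}` an effective Cartier divisor, on an affine
open `W ⊆ X ×_S S'` with `W ∖ E = D(t)`, a section `x ∈ Γ(W)` lies in the ideal of the strict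
transform of `X` iff `tⁿ x = 0` for some `n`; i.e. affine-locally
`𝒪_{X'} = 𝒪_{X ×_S S'} / (t-power torsion)`, the module `M'` of Stacks 0810 for `M = 𝒪_X`.
[cite: StacksProject, Tag 080C] -/
theorem mem_ideal_blowupStrictTransform_iff (hE : IsEffectiveCartier (I.comap b))
    (W : (pullback f b).affineOpens) (t : Γ(pullback f b, W))
    (hW : (pullback.snd f b ⁻¹ᵁ (b ⁻¹ᵁ centreCompl I)) ⊓ (W : (pullback f b).Opens) =
      (pullback f b).basicOpen t) (x : Γ(pullback f b, W)) :
    x ∈ (blowupStrictTransformι f b I).ker.ideal W ↔ ∃ n : ℕ, t ^ n * x = 0 := by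
  rw [ker_blowupStrictTransformι]
  haveI : QuasiCompact (pullback.snd f b ⁻¹ᵁ (b ⁻¹ᵁ centreCompl I)).ι := by
    rw [preimage_centreCompl]
    exact quasiCompact_ι_preimage_centreCompl _ hE
  exact mem_ker_ι_ideal_iff_exists_pow_mul_eq_zero _ W t hW x

end StrictTransform

end Literature.AlgebraicGeometry.Resolution

end
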